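import Summits.BirchSwinnertonDyer.BirchSwinnertonDyer.Theorems.CMKolyvaginAtInertTwoPairDataAtTwo
import HarnessLib

/-!
# Route `CMKolyvaginAtInertTwo`, crux `CMKolyvaginExactAtInertTwo` (stmt-BirchSwinnertonDyer-24277):
# THE VALUE FORMULA `hCTV` OF A SUM PAIRING FROM ITS TWO MEMBER FORMULAS (pure bookkeeping)

Seat `bsd-line-cmk2-p1` g14 (cell `bsd-print-cf2`); helper (`--supports stmt-BirchSwinnertonDyer-24277`).
THEOREMS ONLY (pure algebra on the Literature carrier `KolyvaginDescent.SplitDataM`): no definition,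
no named fact, no `sorry`; no item is closed; BSD is not proved by this.

The telescope theorems `card_mul_card_le_two_pow_two_mul[_of_injective]` (p689732, p690708) consume
McCallum's Cassels–Tate value formula `hCTV` for a pairing `P` on `Sd.Sel`. In the T2 design `P` has
NO CROSS TERMS in coordinates `J₁ : T₁ → V'`, `J₂ : T₂ → V'` (`T₁ = Sel_{2^M}(E^{ε}/ℚ)`,
`T₂ = Sel_{2^M}(E^{−ε}/ℚ)`): `P(J₁t₁ + J₂t₂, J₁t₁' + J₂t₂') = Q₁(t₁,t₁') + Q₂(t₂,t₂')`
(`transportPairing_apply`, p690020). Since Kolyvagin's class `c(n)` and the test class `t` of `hCTV`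
are PURE of the same sign `ε(−1)^{r(n)}` (`Sd.c_eig`), the value `P(p^j c(ℓm), t)` is a value of
`Q₁` (depth `r(ℓm)` even) or of `Q₂` (odd). Hence `hCTV` follows from the two MEMBER formulas `hV₁`,
`hV₂` (McCallum Prop. 4.7 + Lemma 5.3 for `E^{ε}`, resp. `E^{−ε}`, over `ℚ`, in `T`-coordinates) —
the analogue on an arbitrary carrier of `Literature.….VisiblePairHypothesesM.hCTV_of_members`.

* `hCTV_of_members` — the splitting.

References: [McCallumLMS1991] §4 Prop. 4.7, §5 Lemma 5.3, Thm. 5.4 (proof); [Kolyvagin1989Izv] §3.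
-/

-- single-conjunct summit: `Summit.BirchSwinnertonDyer.BirchSwinnertonDyer.…` repeats the name by design
set_option linter.dupNamespace false
set_option autoImplicit false

noncomputable section

open scoped Classical
open Literature.NumberTheory.EllipticCurves Literature.NumberTheory.EllipticCurves.KolyvaginDescent

namespace Summit.BirchSwinnertonDyer.BirchSwinnertonDyer.Theorems.KolyvaginPairDataTwo

/-- **`hCTV` of a pairing without cross terms from its two member formulas.** `Sd` split descent
data on `V'`; `J₁ : T₁ → V'`, `J₂ : T₂ → V'` injective with `Sd.Sel ≤ J₁(T₁) + J₂(T₂)`, pure parts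
read off by the eigengroups (`J₁t₁ + J₂t₂ ∈ V'^{ε} ⟹ J₂t₂ = 0`, `∈ V'^{−ε} ⟹ J₁t₁ = 0`); `P` on
`Sd.Sel` with `P(J₁t₁ + J₂t₂, J₁t₁' + J₂t₂') = Q₁ t₁ t₁' + Q₂ t₂ t₂'`. If `Q₁` satisfies McCallum's
value formula for the levels `n = ℓm` of EVEN depth and `Q₂` for ODD depth (in `T`-coordinates), then
`P` satisfies `hCTV`. [cite: McCallumLMS1991, §4 Prop. 4.7, §5 Lemma 5.3, Thm. 5.4 (proof)]
[cite: Kolyvagin1989Izv, §3] -/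
theorem hCTV_of_members {V' : Type*} [AddCommGroup V'] {Pl : Type*} (Sd : SplitDataM V' Pl)
    {T₁ T₂ R : Type*} [AddCommGroup T₁] [AddCommGroup T₂] [AddCommGroup R]
    (J₁ : T₁ →+ V') (J₂ : T₂ →+ V') (hJ₁ : Function.Injective J₁) (hJ₂ : Function.Injective J₂)
    (hSelJ : ∀ s ∈ Sd.Sel, ∃ t₁ t₂, s = J₁ t₁ + J₂ t₂)
    (hpure₁ : ∀ t₁ t₂, J₁ t₁ + J₂ t₂ ∈ Sd.eig Sd.ε → J₂ t₂ = 0)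
    (hpure₂ : ∀ t₁ t₂, J₁ t₁ + J₂ t₂ ∈ Sd.eig (-Sd.ε) → J₁ t₁ = 0)
    (P : Sd.Sel →+ Sd.Sel →+ R) (Q₁ : T₁ →+ T₁ →+ R) (Q₂ : T₂ →+ T₂ →+ R)
    (hP : ∀ (t₁ t₁' : T₁) (t₂ t₂' : T₂) (h : J₁ t₁ + J₂ t₂ ∈ Sd.Sel) (h' : J₁ t₁' + J₂ t₂' ∈ Sd.Sel),
      P ⟨J₁ t₁ + J₂ t₂, h⟩ ⟨J₁ t₁' + J₂ t₂', h'⟩ = Q₁ t₁ t₁' + Q₂ t₂ t₂')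
    (hV₁ : ∀ ℓ m : ℕ, Sd.Kol ℓ → KolSupp Sd.Kol (ℓ * m) → ¬ ℓ ∣ m → Even (ℓ * m).primeFactors.card →
      ∀ (j N a b : ℕ) (t₁ z₁ : T₁), J₁ t₁ ∈ Sd.Sel → ((Sd.p : ℤ) ^ j) • Sd.c (ℓ * m) = J₁ z₁ →
      J₁ z₁ ∈ Sd.Sel → ((Sd.p : ℤ) ^ N) • J₁ t₁ = 0 → (∀ q ∈ m.primeFactors, J₁ t₁ ∈ Sd.A q) →
      Sd.M - Sd.M₀ ≤ j → N + Sd.M₀ ≤ Sd.M → N ≤ j → a + b + 1 = N →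
      ((Sd.p : ℤ) ^ (a + (j - N))) • Sd.c m ∉ Sd.A ℓ → ((Sd.p : ℤ) ^ b) • J₁ t₁ ∉ Sd.A ℓ →
      Q₁ z₁ t₁ ≠ 0)
    (hV₂ : ∀ ℓ m : ℕ, Sd.Kol ℓ → KolSupp Sd.Kol (ℓ * m) → ¬ ℓ ∣ m → Odd (ℓ * m).primeFactors.card →
      ∀ (j N a b : ℕ) (t₂ z₂ : T₂), J₂ t₂ ∈ Sd.Sel → ((Sd.p : ℤ) ^ j) • Sd.c (ℓ * m) = J₂ z₂ →
      J₂ z₂ ∈ Sd.Sel → ((Sd.p : ℤ) ^ N) • J₂ t₂ = 0 → (∀ q ∈ m.primeFactors, J₂ t₂ ∈ Sd.A q) →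
      Sd.M - Sd.M₀ ≤ j → N + Sd.M₀ ≤ Sd.M → N ≤ j → a + b + 1 = N →
      ((Sd.p : ℤ) ^ (a + (j - N))) • Sd.c m ∉ Sd.A ℓ → ((Sd.p : ℤ) ^ b) • J₂ t₂ ∉ Sd.A ℓ →
      Q₂ z₂ t₂ ≠ 0) :
    ∀ ℓ m : ℕ, Sd.Kol ℓ → KolSupp Sd.Kol (ℓ * m) → ¬ ℓ ∣ m →
      ∀ (j N a b : ℕ) (t : V') (ht : t ∈ Sd.Sel) (hz : ((Sd.p : ℤ) ^ j) • Sd.c (ℓ * m) ∈ Sd.Sel),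
      ((Sd.p : ℤ) ^ N) • t = 0 → t ∈ Sd.eig (Sd.ε * (-1) ^ (ℓ * m).primeFactors.card) →
      (∀ q ∈ m.primeFactors, t ∈ Sd.A q) → Sd.M - Sd.M₀ ≤ j → N + Sd.M₀ ≤ Sd.M → N ≤ j →
      a + b + 1 = N →
      ((Sd.p : ℤ) ^ (a + (j - N))) • Sd.c m ∉ Sd.A ℓ → ((Sd.p : ℤ) ^ b) • t ∉ Sd.A ℓ →
      P ⟨_, hz⟩ ⟨t, ht⟩ ≠ 0 := by
  intro ℓ m hℓ hsupp hndvd j N a b t ht hz hN hte hAq hj hNM hNj hab hcm hbt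
  -- the class `z = p^j c(ℓm)` and the test class `t` in coordinates
  obtain ⟨z₁, z₂, hz12⟩ := hSelJ _ hz
  obtain ⟨t₁, t₂, rfl⟩ := hSelJ t ht
  have hzeig : ((Sd.p : ℤ) ^ j) • Sd.c (ℓ * m) ∈ Sd.eig (Sd.ε * (-1) ^ (ℓ * m).primeFactors.card) :=
    AddSubgroup.zsmul_mem _ (Sd.c_eig (ℓ * m) hsupp) _
  have hval : P ⟨_, hz⟩ ⟨J₁ t₁ + J₂ t₂, ht⟩ = Q₁ z₁ t₁ + Q₂ z₂ t₂ := by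
    have hz' : J₁ z₁ + J₂ z₂ ∈ Sd.Sel := by rw [← hz12]; exact hz
    have heq : (⟨_, hz⟩ : Sd.Sel) = ⟨J₁ z₁ + J₂ z₂, hz'⟩ := Subtype.ext hz12
    rw [heq]
    exact hP z₁ t₁ z₂ t₂ hz' ht
  rw [hval]
  rcases Nat.even_or_odd (ℓ * m).primeFactors.card with hev | hodd
  · -- EVEN depth: everything lives on the first member
    rw [hev.neg_one_pow, mul_one] at hte hzeig
    have ht2 : J₂ t₂ = 0 := hpure₁ t₁ t₂ hte
    rw [hz12] at hzeig
    have hz2 : J₂ z₂ = 0 := hpure₁ z₁ z₂ hzeig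
    have ht20 : t₂ = 0 := hJ₂ (by rw [ht2, map_zero])
    have hz20 : z₂ = 0 := hJ₂ (by rw [hz2, map_zero])
    rw [ht20, hz20]
    simp only [map_zero, add_zero]
    rw [ht2, add_zero] at ht hN hAq hbt
    rw [hz2, add_zero] at hz12
    have hzSel : J₁ z₁ ∈ Sd.Sel := by rw [← hz12]; exact hz
    exact hV₁ ℓ m hℓ hsupp hndvd hev j N a b t₁ z₁ ht hz12 hzSel hN hAq hj hNM hNj hab hcm hbt
  · -- ODD depth: everything lives on the second member
    rw [hodd.neg_one_pow, mul_neg_one] at hte hzeig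
    have ht1 : J₁ t₁ = 0 := hpure₂ t₁ t₂ hte
    rw [hz12] at hzeig
    have hz1 : J₁ z₁ = 0 := hpure₂ z₁ z₂ hzeig
    have ht10 : t₁ = 0 := hJ₁ (by rw [ht1, map_zero])
    have hz10 : z₁ = 0 := hJ₁ (by rw [hz1, map_zero])
    rw [ht10, hz10]
    simp only [map_zero, zero_add]
    rw [ht1, zero_add] at ht hN hAq hbt
    rw [hz1, zero_add] at hz12
    have hzSel : J₂ z₂ ∈ Sd.Sel := by rw [← hz12]; exact hz
    exact hV₂ ℓ m hℓ hsupp hndvd hodd j N a b t₂ z₂ ht hz12 hzSel hN hAq hj hNM hNj hab hcm hbt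

end Summit.BirchSwinnertonDyer.BirchSwinnertonDyer.Theorems.KolyvaginPairDataTwo

end
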